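import Mathlib
import Literature.RingTheory.MvPolynomial.WeightMonomialOrder

/-!
# TropicalLinks / SchonResolves — the `≺_{w,m}`-leading term of `f` is the `m`-leading term of `in_w f`

Route `ResolutionOfSingularities/TropicalLinks`, crux `SchonResolves` (stmt-ResolutionOfSingularities-17234),
line `zariski-toric-closure`, stub GB1 (Gröbner basics): for the weight monomial order
`≺_{w,m}` ("compare the `w`-weight first, then `m`", tree `Literature.RingTheory.MvPolynomial.weightLex`)
and a nonzero polynomial `f`, the leading exponent and the leading coefficient of `f` for `≺_{w,m}`
are those of its top `w`-homogeneous component `in_w f` for `m`; in particular `in_w f ≠ 0`.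
Here `in_w f` is written without new definitions as
`MvPolynomial.weightedHomogeneousComponent w (MvPolynomial.weightedTotalDegree w f) f`
(max-convention, as for Mathlib's `MonomialOrder.degree`).

* `schonResolves_degree_eq_of_mem_support_of_forall_le` — characterisation of `m.degree g` as the
  `m`-maximum of the support;
* `schonResolves_mem_support_topComponent_iff` — the support of `in_w f` is the part of the support
  of `f` of top weight;
* `schonResolves_degree_weightLex_eq_degree_topComponent` (GB1, the registered stub).

Proof: `u := deg_{≺_{w,m}} f` has weight `wdeg f` (tree lemma `weight_degree_weightLex`), so
`coeff u (in_w f) = coeff u f ≠ 0`; every exponent `d` of `in_w f` has the same weight and lies in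
the support of `f`, so `d ≼_{w,m} u`, i.e. `d ≼_m u` (`weightLex_le_iff_of_weight_eq`); hence `u`
is the `m`-maximum of the support of `in_w f`. References: Sturmfels, *Gröbner Bases and Convex
Polytopes*, Ch. 1 (before Prop. 1.8); Cox–Little–O'Shea, Ch. 2 §4, Exercises 11–12.
-/

-- single-problem summit: the doubled namespace component `ResolutionOfSingularities` is forced
set_option linter.dupNamespace false

namespace Summit.ResolutionOfSingularities.ResolutionOfSingularities.Theorems

open MvPolynomial

/-- **The degree for a monomial order is the maximum of the support**: if `u` lies in the support
of `g` and dominates every exponent of the support for `m`, then `m.degree g = u`. [folklore] -/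
theorem schonResolves_degree_eq_of_mem_support_of_forall_le {σ : Type*} {R : Type*}
    [CommSemiring R] (m : MonomialOrder σ) {g : MvPolynomial σ R} {u : σ →₀ ℕ}
    (hu : u ∈ g.support) (hle : ∀ d ∈ g.support, m.toSyn d ≤ m.toSyn u) : m.degree g = u := by
  apply m.toSyn.injective
  exact le_antisymm (m.degree_le_iff.2 hle) (m.le_degree hu)

/-- **Support of the top `w`-component**: `d` lies in the support of
`in_w f = weightedHomogeneousComponent w (wdeg f) f` iff it lies in the support of `f` and has
weight `wdeg f`. [folklore] -/
theorem schonResolves_mem_support_topComponent_iff {σ : Type*} {R : Type*} [CommSemiring R]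
    (w : σ → ℕ) (f : MvPolynomial σ R) (d : σ →₀ ℕ) :
    d ∈ (weightedHomogeneousComponent w (weightedTotalDegree w f) f).support ↔
      d ∈ f.support ∧ Finsupp.weight w d = weightedTotalDegree w f := by
  classical
  rw [mem_support_iff, mem_support_iff, coeff_weightedHomogeneousComponent]
  by_cases h : Finsupp.weight w d = weightedTotalDegree w f
  · simp only [h, if_true, ne_eq, and_true]
  · simp only [h, if_false, ne_eq, not_true_eq_false, and_false]

/-- **GB1 — the `≺_{w,m}`-leading term lies on the top `w`-component.** For a field `k`, a weight
`w : σ → ℕ`, a monomial order `m` and `f ≠ 0`: (1) the leading exponent of `f` for the weight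
order `≺_{w,m}` is the `m`-leading exponent of `in_w f`; (2) `in_w f ≠ 0`; (3) the leading
coefficients agree. [cite: Sturmfels1996GBCP, Ch. 1 (weight term orders, before Prop. 1.8)] -/
theorem schonResolves_degree_weightLex_eq_degree_topComponent : ∀ (k : Type) [Field k]
    (σ : Type) (w : σ → ℕ) (m : MonomialOrder σ) (f : MvPolynomial σ k), f ≠ 0 →
      (Literature.RingTheory.MvPolynomial.weightLex w m).degree f =
          m.degree (MvPolynomial.weightedHomogeneousComponent w
            (MvPolynomial.weightedTotalDegree w f) f) ∧
        MvPolynomial.weightedHomogeneousComponent w (MvPolynomial.weightedTotalDegree w f) f ≠ 0 ∧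
        (Literature.RingTheory.MvPolynomial.weightLex w m).leadingCoeff f =
          m.leadingCoeff (MvPolynomial.weightedHomogeneousComponent w
            (MvPolynomial.weightedTotalDegree w f) f) := by
  intro k _ σ w m f hf
  classical
  -- `u := deg_{≺_{w,m}} f` has top weight and a nonzero coefficient in `f`
  have hwt : Finsupp.weight w ((Literature.RingTheory.MvPolynomial.weightLex w m).degree f) =
      weightedTotalDegree w f :=
    Literature.RingTheory.MvPolynomial.weight_degree_weightLex hf
  have hmemf : (Literature.RingTheory.MvPolynomial.weightLex w m).degree f ∈ f.support :=
    MonomialOrder.degree_mem_support hf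
  -- hence `u` lies in the support of `in_w f`
  have hmem : (Literature.RingTheory.MvPolynomial.weightLex w m).degree f ∈
      (weightedHomogeneousComponent w (weightedTotalDegree w f) f).support :=
    (schonResolves_mem_support_topComponent_iff w f _).2 ⟨hmemf, hwt⟩
  -- and dominates it for `m` (equal weights: `≼_{w,m}` is `≼_m`)
  have hle : ∀ d ∈ (weightedHomogeneousComponent w (weightedTotalDegree w f) f).support,
      m.toSyn d ≤ m.toSyn ((Literature.RingTheory.MvPolynomial.weightLex w m).degree f) := by
    intro d hd
    obtain ⟨hdf, hdw⟩ := (schonResolves_mem_support_topComponent_iff w f d).1 hd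
    exact (Literature.RingTheory.MvPolynomial.weightLex_le_iff_of_weight_eq (hdw.trans hwt.symm)).1
      ((Literature.RingTheory.MvPolynomial.weightLex w m).le_degree hdf)
  have hdeg : (Literature.RingTheory.MvPolynomial.weightLex w m).degree f =
      m.degree (weightedHomogeneousComponent w (weightedTotalDegree w f) f) :=
    (schonResolves_degree_eq_of_mem_support_of_forall_le m hmem hle).symm
  refine ⟨hdeg, ?_, ?_⟩
  · -- (2) `in_w f ≠ 0`: its support contains `u`
    intro h0
    rw [h0, support_zero] at hmem
    exact Finset.notMem_empty _ hmem
  · -- (3) leading coefficients: `coeff u (in_w f) = coeff u f` since `weight u = wdeg f`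
    change f.coeff ((Literature.RingTheory.MvPolynomial.weightLex w m).degree f) =
      (weightedHomogeneousComponent w (weightedTotalDegree w f) f).coeff
        (m.degree (weightedHomogeneousComponent w (weightedTotalDegree w f) f))
    rw [← hdeg, coeff_weightedHomogeneousComponent, if_pos hwt]

end Summit.ResolutionOfSingularities.ResolutionOfSingularities.Theorems
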